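import Literature.AlgebraicGeometry.Frobenioids.Cor411iiOfPreSteps
import Literature.AlgebraicGeometry.Frobenioids.TwinPrimarySquares
import HarnessLib

/-!
# Frobenioids I, Corollary 4.11 (ii) AS TYPED from Theorem 3.4 (ii) AS TYPED — II: the amended route through
# `(C^istr)^un-tr`; hence over bases of FSMFF-type in the author's revised (2024) sense, unconditionally

Mochizuki, *The geometry of Frobenioids I: the general theory*, Kyushu J. Math. **62** (2008)
293–400, Cor. 4.11 (ii) p. 91, proof pp. 92–94 [cite: MochizukiFrdI2008, Cor. 4.11 (ii) p.91]; the author's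
*Comments* (Jan. 2024), items (28) (revised "FSMFF-type") and (29)(v) (the amended first paragraph of the
proof of Cor. 4.11 (ii): "by assertion (i), we may assume without loss of generality that `C` is of
unit-trivial, hence also [cf. Proposition 4.4, (iii)] birationally Frobenius-normalized type").

PROOF-ONLY file (seat abc-iut-L1-d6, cell sub-DAG S2 `plan/L1/SUBDAG-FrdI-Cor411.md`, node FrdI:Cor4.11(ii);
GAP row G-L1d8-1 "FSMFF ∖ FSM"; part I is `Cor411iiOfPreSteps`).
* `cor411ii_ofFunctor_of_preservesPreSteps` — **the typed Cor. 4.11 (ii) for Frobenioids with `Φ_i`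
  perf-factorial, from the conclusion of Thm. 3.4 (ii) for `Ψ`, `Ψ⁻¹` ("preserve pre-steps and group-like
  objects") and nothing else**: the route of `cor411ii_ofFunctor_of_isOfFSMType` (`Cor411iiAssemblyFSM`) with
  Thm. 4.2 (i) by `FrdI.T42.thm42i_ofFunctor_of_preservesPreSteps` (seat abc-iut-w4-d105), Thm. 3.4 (iii) by
  `FrdI.OfPreSteps.thm34iii_ofFunctor` (seat abc-iut-L1-t11), Cor. 4.11 (i) by `cor411i_restrict`; the
  pre-step clause DESCENDS to `Ψ^un-tr`, `(Ψ^un-tr)⁻¹` along the full, essentially surjective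
  `C_i^istr → (C_i^istr)^un-tr`, a class being a pre-step iff a representative is (Prop. 3.3 (iii)/(iv);
  private transport lemmas `map_mem_of_full_square`, `nonempty_inverse_square`); then `cor411ii_of_preservesPreSteps_of_not_isOfGroupLikeType`
  at the unit-trivializations (both its inputs PROVED there: Prop. 3.2 (iii) `Perfection.isFrobenioid`,
  Prop. 4.4 (ii)/(iii) amended `Perfection.birat_isFrobenioid_of_isOfUnitTrivialType`) and descent along
  `C_i → C_i^istr → (C_i^istr)^un-tr` (`cor411ii_of_over`);
* `cor411ii_ofFunctor_of_thm34ii` — **the typed Cor. 4.11 (ii) from the typed Thm. 3.4 (ii)**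
  (`PreFrobenioidData.Thm34ii` for `Ψ` and `Ψ⁻¹`; its antecedents "quasi-isotropic type" and "bases of
  FSMFF-type" are clauses (a), (d) of the standard type recorded in `Cor411Setting`);
* `cor411ii_ofFunctor_of_isOfFSMFFType2024` — **the typed Cor. 4.11 (ii) over bases of FSMFF-type in the
  revised (2024) sense, unconditionally** (Thm. 3.4 (ii) there: `FrdI.thm34ii_of_isOfFSMFFType2024`, seat
  abc-iut-L1-t11) — the generality in which the author now states §3–§4.
Over bases of FSMFF-type in the 2008 wording only, the typed Cor. 4.11 (ii) holds as soon as the typed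
Thm. 3.4 (ii) does (GAP G-L1d8-1); nothing is claimed about that case here.
No new definitions; nothing of the paper is restated; nothing here is specific to the abc programme.
-/

namespace Literature.AlgebraicGeometry.Frobenioids

open CategoryTheory Opposite

universe w v v' u u'

namespace PreFrobenioid

section Transport

/-- A natural isomorphism `K ≅ K'` conjugates `K f` into `K' f` by isomorphisms; so a class of arrows stable
under composition with isomorphisms on both sides contains `K f` as soon as it contains `K' f`. [folklore] -/
private theorem map_mem_of_natIso {A : Type*} [Category A] {B : Type*} [Category B] {K K' : A ⥤ B} (σ : K ≅ K')
    (P : ∀ ⦃X Y : B⦄, (X ⟶ Y) → Prop)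
    (hP : ∀ ⦃X' X Y Y' : B⦄ (e : X' ⟶ X) (g : X ⟶ Y) (e' : Y ⟶ Y') [IsIso e] [IsIso e'], P g → P (e ≫ g ≫ e'))
    ⦃a b : A⦄ (f : a ⟶ b) (h : P (K'.map f)) : P (K.map f) := by
  have e : K.map f = σ.hom.app a ≫ K'.map f ≫ σ.inv.app b := by
    rw [← Category.assoc, ← σ.hom.naturality f, Category.assoc, Iso.hom_inv_id_app, Category.comp_id]
  rw [e]
  exact hP _ _ _ h

/-- **Transport of a class of arrows along a `1`-commutative square with a full, essentially surjective
left leg** (the shape of the squares `C^istr → C^un-tr` of Thm. 3.4 (iv) / Cor. 4.11 (i), Prop. 3.3 (iii)):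
given `ρ : G ⋙ T₂ ≅ T₁ ⋙ H` with `T₁` full and essentially surjective, classes of arrows `P₁`, `P₂` stable
under composition with isomorphisms, and the implication "`T₁ f ∈ P₁ ⟹ T₂ (G f) ∈ P₂`" on representatives,
the functor `H` carries `P₁` into `P₂`. [cite: MochizukiFrdI2008, Prop. 3.3 (iii) p.59] -/
private theorem map_mem_of_full_square {A₁ : Type*} [Category A₁] {A₂ : Type*} [Category A₂] {B₁ : Type*}
    [Category B₁] {B₂ : Type*} [Category B₂] (T₁ : A₁ ⥤ B₁) [T₁.Full] [T₁.EssSurj] (T₂ : A₂ ⥤ B₂)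
    (G : A₁ ⥤ A₂) (H : B₁ ⥤ B₂) (ρ : G ⋙ T₂ ≅ T₁ ⋙ H)
    (P₁ : ∀ ⦃X Y : B₁⦄, (X ⟶ Y) → Prop) (P₂ : ∀ ⦃X Y : B₂⦄, (X ⟶ Y) → Prop)
    (hP₁ : ∀ ⦃X' X Y Y' : B₁⦄ (e : X' ⟶ X) (g : X ⟶ Y) (e' : Y ⟶ Y') [IsIso e] [IsIso e'],
      P₁ g → P₁ (e ≫ g ≫ e'))
    (hP₂ : ∀ ⦃X' X Y Y' : B₂⦄ (e : X' ⟶ X) (g : X ⟶ Y) (e' : Y ⟶ Y') [IsIso e] [IsIso e'],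
      P₂ g → P₂ (e ≫ g ≫ e'))
    (hlift : ∀ ⦃a b : A₁⦄ (f : a ⟶ b), P₁ (T₁.map f) → P₂ (T₂.map (G.map f))) ⦃X Y : B₁⦄ (g : X ⟶ Y)
    (hg : P₁ g) : P₂ (H.map g) := by
  let eX : T₁.obj (T₁.objPreimage X) ≅ X := T₁.objObjPreimageIso X
  let eY : T₁.obj (T₁.objPreimage Y) ≅ Y := T₁.objObjPreimageIso Y
  let f : T₁.objPreimage X ⟶ T₁.objPreimage Y := T₁.preimage (eX.hom ≫ g ≫ eY.inv)
  have hf : T₁.map f = eX.hom ≫ g ≫ eY.inv := T₁.map_preimage _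
  have h1 : P₂ (T₂.map (G.map f)) := hlift f (by rw [hf]; exact hP₁ _ _ _ hg)
  have h2 : P₂ ((T₁ ⋙ H).map f) := map_mem_of_natIso ρ.symm P₂ hP₂ f h1
  have e : g = eX.inv ≫ (eX.hom ≫ g ≫ eY.inv) ≫ eY.hom := by simp
  rw [e, ← hf, H.map_comp, H.map_comp]
  exact hP₂ _ _ _ h2

/-- The mate of a `1`-commutative square of equivalences: from `E₁ ⋙ T₂ ≅ T₁ ⋙ E₂` one gets
`E₁⁻¹ ⋙ T₁ ≅ T₂ ⋙ E₂⁻¹` (units and counits). [folklore] -/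
private theorem nonempty_inverse_square {A₁ : Type*} [Category A₁] {A₂ : Type*} [Category A₂] {B₁ : Type*}
    [Category B₁] {B₂ : Type*} [Category B₂] (E₁ : A₁ ≌ A₂) (E₂ : B₁ ≌ B₂) (T₁ : A₁ ⥤ B₁) (T₂ : A₂ ⥤ B₂)
    (ρ : E₁.functor ⋙ T₂ ≅ T₁ ⋙ E₂.functor) : Nonempty (E₁.inverse ⋙ T₁ ≅ T₂ ⋙ E₂.inverse) :=
  ⟨(Functor.rightUnitor _).symm ≪≫ Functor.isoWhiskerLeft (E₁.inverse ⋙ T₁) E₂.unitIso ≪≫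
    (Functor.associator _ _ _).symm ≪≫
      Functor.isoWhiskerRight (Functor.associator _ _ _ ≪≫ Functor.isoWhiskerLeft E₁.inverse ρ.symm ≪≫
        (Functor.associator _ _ _).symm ≪≫ Functor.isoWhiskerRight E₁.counitIso T₂ ≪≫ Functor.leftUnitor T₂)
        E₂.inverse⟩

end Transport

section Two

variable {D₁ : Type u} [Category.{v} D₁] {Φ₁ : D₁ᵒᵖ ⥤ CommMonCat.{w}}
  {C₁ : Type u'} [Category.{v'} C₁] {F₁ : C₁ ⥤ ElemFrobenioid Φ₁}
  {D₂ : Type u} [Category.{v} D₂] {Φ₂ : D₂ᵒᵖ ⥤ CommMonCat.{w}}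
  {C₂ : Type u'} [Category.{v'} C₂] {F₂ : C₂ ⥤ ElemFrobenioid Φ₂}

set_option backward.isDefEq.respectTransparency false in
/-- **[FrdI] Cor. 4.11 (ii) AS TYPED from the conclusion of Thm. 3.4 (ii) — no hypothesis on the bases**:
for Frobenioids `C_i → F_{Φ_i}` with `Φ_i` perf-factorial and an equivalence `Ψ : C₁ ⥲ C₂` such that `Ψ` and
`Ψ⁻¹` preserve pre-steps and group-like objects, the typed Cor. 4.11 (ii) holds: under `Cor411Setting`
(Div-slim bases, standard type, hypothesis (b)) there is a `1`-unique base equivalence `Ψ^Base` under `Ψ`,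
with rigid composites for slim bases. Route of `cor411ii_ofFunctor_of_isOfFSMType` (author's Comments (2024)
(29)(v)): group-like ⇒ slim ⇒ Thm. 3.4 (v); else restrict to `C_i^istr`, where Thm. 4.2 (i)
(`FrdI.T42.thm42i_ofFunctor_of_preservesPreSteps`) and Cor. 4.11 (i) (`cor411i_restrict`, Thm. 3.4 (iii) by
`FrdI.OfPreSteps.thm34iii_ofFunctor`) give `Ψ^un-tr : (C₁^istr)^un-tr ⥲ (C₂^istr)^un-tr` over `Ψ^istr`; the
pre-step clause DESCENDS to `Ψ^un-tr`, `(Ψ^un-tr)⁻¹` along the full, essentially surjective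
`C_i^istr → (C_i^istr)^un-tr` (`map_mem_of_full_square`; a class is a pre-step iff a representative is,
Prop. 3.3 (iv)); `(C_i^istr)^un-tr → F_{Φ_i}` are Frobenioids of standard, isotropic, unit-trivial,
non-group-like type, so `cor411ii_of_preservesPreSteps_of_not_isOfGroupLikeType` applies to `Ψ^un-tr` with
both its inputs PROVED (Prop. 3.2 (iii) `Perfection.isFrobenioid`; Prop. 4.4 (ii)/(iii) amended,
`Perfection.birat_isFrobenioid_of_isOfUnitTrivialType`); descent along `C_i → C_i^istr → (C_i^istr)^un-tr`
(`cor411ii_of_over`). [cite: MochizukiFrdI2008, Cor. 4.11 (ii) p.91] -/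
theorem cor411ii_ofFunctor_of_preservesPreSteps (hF₁ : IsFrobenioid F₁) (hF₂ : IsFrobenioid F₂) (Ψ : C₁ ≌ C₂)
    (hpf₁ : Objectwise (fun M _ => IsPerfFactorial M) Φ₁) (hpf₂ : Objectwise (fun M _ => IsPerfFactorial M) Φ₂)
    (h₁₂ : PreFrobenioidData.PreservesMor Ψ.functor (PreFrobenioidData.ofFunctor Φ₁ F₁).IsPreStep
      (PreFrobenioidData.ofFunctor Φ₂ F₂).IsPreStep)
    (h₂₁ : PreFrobenioidData.PreservesMor Ψ.inverse (PreFrobenioidData.ofFunctor Φ₂ F₂).IsPreStep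
      (PreFrobenioidData.ofFunctor Φ₁ F₁).IsPreStep)
    (hG : PreFrobenioidData.PreservesObj Ψ.functor (PreFrobenioidData.ofFunctor Φ₁ F₁).IsGroupLikeObj
      (PreFrobenioidData.ofFunctor Φ₂ F₂).IsGroupLikeObj)
    (hG' : PreFrobenioidData.PreservesObj Ψ.inverse (PreFrobenioidData.ofFunctor Φ₂ F₂).IsGroupLikeObj
      (PreFrobenioidData.ofFunctor Φ₁ F₁).IsGroupLikeObj) :
    (PreFrobenioidData.ofFunctor Φ₁ F₁).Cor411ii (PreFrobenioidData.ofFunctor Φ₂ F₂) Ψ := by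
  classical
  intro hs
  have hq₁ := hs.standard.1.quasiIsotropic
  have hq₂ := hs.standard.2.quasiIsotropic
  rcases FrdI.OfPreSteps.groupLike_dichotomy Ψ hG hG' with ⟨hg₁, hg₂⟩ | ⟨⟨N₁, hN₁⟩, ⟨N₂, hN₂⟩⟩
  · -- group-like type: "Div-slimness amounts to slimness", and the slim case is Thm. 3.4 (v)
    have hsl₁ : IsSlim D₁ := PreFrobenioidData.isSlim_of_isDivSlim_of_isOfGroupLikeType _
      (exists_base_iso_of_isFrobenioid F₁ hF₁) hg₁ hs.divSlim.1
    have hsl₂ : IsSlim D₂ := PreFrobenioidData.isSlim_of_isDivSlim_of_isOfGroupLikeType _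
      (exists_base_iso_of_isFrobenioid F₂ hF₂) hg₂ hs.divSlim.2
    exact cor411ii_inst_of_isSlim_of_thm34iii F₁ F₂ Ψ hF₁ hF₂ hsl₁ hsl₂
      (FrdI.OfPreSteps.thm34iii_ofFunctor hF₁ hF₂ Ψ h₁₂ h₂₁ hG hG')
      (FrdI.OfPreSteps.thm34iii_ofFunctor hF₂ hF₁ Ψ.symm h₂₁ h₁₂ hG' hG) hs
  · -- not of group-like type, on both sides
    have hG₁ : ¬ (PreFrobenioidData.ofFunctor Φ₁ F₁).IsOfGroupLikeType := fun h => hN₁ (h.obj N₁)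
    have hG₂ : ¬ (PreFrobenioidData.ofFunctor Φ₂ F₂).IsOfGroupLikeType := fun h => hN₂ (h.obj N₂)
    -- the isotropic parts `C_i^istr → F_{Φ_i}` and `Ψ^istr` (Thm. 3.4 (i))
    haveI : (isotropicObjects F₂).IsClosedUnderIsomorphisms :=
      ⟨fun e h => IsIsotropic.of_iso hF₂.isPreFrobenioid e.symm h⟩
    have hinv := FrdI.isotropicObjects_inverseImage hF₁ hq₁ hq₂ Ψ
    let Ψif := Ψ.congrFullSubcategory hinv
    have hI₁ := isFrobenioid_istr hF₁
    have hI₂ := isFrobenioid_istr hF₂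
    have hSI₁ := isOfStandardType_istr hF₁ hs.standard.1
    have hSI₂ := isOfStandardType_istr hF₂ hs.standard.2
    have hGI₁ : ¬ (PreFrobenioidData.ofFunctor Φ₁ (istrFunctor F₁)).IsOfGroupLikeType := fun h =>
      hG₁ (isOfGroupLikeType_of_istr' hF₁ h)
    have hGI₂ : ¬ (PreFrobenioidData.ofFunctor Φ₂ (istrFunctor F₂)).IsOfGroupLikeType := fun h =>
      hG₂ (isOfGroupLikeType_of_istr' hF₂ h)
    have hBI : (PreFrobenioidData.ofFunctor Φ₁ (istrFunctor F₁)).HypB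
        (PreFrobenioidData.ofFunctor Φ₂ (istrFunctor F₂)) Ψif := fun g _ => (hGI₁ g).elim
    have hBI' : (PreFrobenioidData.ofFunctor Φ₂ (istrFunctor F₂)).HypB
        (PreFrobenioidData.ofFunctor Φ₁ (istrFunctor F₁)) Ψif.symm := fun g _ => (hGI₂ g).elim
    have hsI : (PreFrobenioidData.ofFunctor Φ₁ (istrFunctor F₁)).Cor411Setting
        (PreFrobenioidData.ofFunctor Φ₂ (istrFunctor F₂)) Ψif :=
      { divSlim := ⟨⟨hs.divSlim.1.eq_one⟩, ⟨hs.divSlim.2.eq_one⟩⟩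
        standard := ⟨hSI₁, hSI₂⟩
        hypB := hBI }
    -- pre-steps / group-like objects of `C_i^istr` are those of `C_i` between isotropic objects
    have h₁₂I : PreFrobenioidData.PreservesMor Ψif.functor (PreFrobenioidData.ofFunctor Φ₁ (istrFunctor F₁)).IsPreStep
        (PreFrobenioidData.ofFunctor Φ₂ (istrFunctor F₂)).IsPreStep := fun X Y φ hφ => h₁₂ φ.hom hφ
    have h₂₁I : PreFrobenioidData.PreservesMor Ψif.inverse (PreFrobenioidData.ofFunctor Φ₂ (istrFunctor F₂)).IsPreStep
        (PreFrobenioidData.ofFunctor Φ₁ (istrFunctor F₁)).IsPreStep := fun X Y φ hφ => h₂₁ φ.hom hφ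
    have hGpI : PreFrobenioidData.PreservesObj Ψif.functor
        (PreFrobenioidData.ofFunctor Φ₁ (istrFunctor F₁)).IsGroupLikeObj
        (PreFrobenioidData.ofFunctor Φ₂ (istrFunctor F₂)).IsGroupLikeObj := fun X hX => hG hX
    have hGpI' : PreFrobenioidData.PreservesObj Ψif.inverse
        (PreFrobenioidData.ofFunctor Φ₂ (istrFunctor F₂)).IsGroupLikeObj
        (PreFrobenioidData.ofFunctor Φ₁ (istrFunctor F₁)).IsGroupLikeObj := fun Y hY => hG' hY
    -- Thm. 3.4 (iii) at the isotropic parts, from (ii): pull-back morphisms for `Ψ^istr`, `(Ψ^istr)⁻¹`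
    have h3 := FrdI.OfPreSteps.thm34iii_ofFunctor hI₁ hI₂ Ψif h₁₂I h₂₁I hGpI hGpI' hSI₁ hSI₂ hBI
    have h3' := FrdI.OfPreSteps.thm34iii_ofFunctor hI₂ hI₁ Ψif.symm h₂₁I h₁₂I hGpI' hGpI hSI₂ hSI₁ hBI'
    have hisoI : ∀ X : Istr F₁, (PreFrobenioidData.ofFunctor Φ₂ (istrFunctor F₂)).IsIsotropic (Ψif.functor.obj X) ↔
        (PreFrobenioidData.ofFunctor Φ₁ (istrFunctor F₁)).IsIsotropic X := fun X =>
      ⟨fun _ => (PreFrobenioidData.ofFunctor_isIsotropic _ _).mpr (isOfIsotropicType_istr X),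
        fun _ => (PreFrobenioidData.ofFunctor_isIsotropic _ _).mpr (isOfIsotropicType_istr _)⟩
    -- Thm. 4.2 (i) at the isotropic parts: `Ψ^istr`, `(Ψ^istr)⁻¹` preserve Div-identity endomorphisms
    have hiI₁ : (PreFrobenioidData.ofFunctor Φ₁ (istrFunctor F₁)).IsOfIsotropicType :=
      (PreFrobenioidData.ofFunctor_isOfIsotropicType _).mpr isOfIsotropicType_istr
    have hiI₂ : (PreFrobenioidData.ofFunctor Φ₂ (istrFunctor F₂)).IsOfIsotropicType :=
      (PreFrobenioidData.ofFunctor_isOfIsotropicType _).mpr isOfIsotropicType_istr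
    have hT : PreFrobenioidData.Thm42Setting (PreFrobenioidData.ofFunctor Φ₁ (istrFunctor F₁))
        (PreFrobenioidData.ofFunctor Φ₂ (istrFunctor F₂)) := ⟨⟨hSI₁, hSI₂⟩, ⟨hiI₁, hiI₂⟩, ⟨hGI₁, hGI₂⟩⟩
    have hT' : PreFrobenioidData.Thm42Setting (PreFrobenioidData.ofFunctor Φ₂ (istrFunctor F₂))
        (PreFrobenioidData.ofFunctor Φ₁ (istrFunctor F₁)) := ⟨⟨hSI₂, hSI₁⟩, ⟨hiI₂, hiI₁⟩, ⟨hGI₂, hGI₁⟩⟩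
    have hdiI : ∀ (X : Istr F₁) (φ : X ⟶ X), (PreFrobenioidData.ofFunctor Φ₁ (istrFunctor F₁)).IsDivIdentity φ →
        (PreFrobenioidData.ofFunctor Φ₂ (istrFunctor F₂)).IsDivIdentity (Ψif.functor.map φ) :=
      (FrdI.T42.thm42i_ofFunctor_of_preservesPreSteps Ψif hI₁ hI₂ hpf₁ hpf₂ (fun _ _ φ h => h₁₂I φ h)
        (fun _ _ φ h => h₂₁I φ h) hT).2.1
    have hdiI' : ∀ (Y : Istr F₂) (φ : Y ⟶ Y), (PreFrobenioidData.ofFunctor Φ₂ (istrFunctor F₂)).IsDivIdentity φ →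
        (PreFrobenioidData.ofFunctor Φ₁ (istrFunctor F₁)).IsDivIdentity (Ψif.inverse.map φ) :=
      (FrdI.T42.thm42i_ofFunctor_of_preservesPreSteps Ψif.symm hI₂ hI₁ hpf₂ hpf₁ (fun _ _ φ h => h₂₁I φ h)
        (fun _ _ φ h => h₁₂I φ h) hT').2.1
    -- Cor. 4.11 (i) at the isotropic parts: `Ψ^un-tr` over `Ψ^istr` (restricted to all of `C^istr`)
    obtain ⟨Ψistr, hcomm, hcor⟩ := cor411i_restrict (istrFunctor F₁) (istrFunctor F₂) Ψif hI₁ hI₂ hisoI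
      ⟨hs.divSlim.1.eq_one⟩ ⟨hs.divSlim.2.eq_one⟩ h3.1.2.2.2.2.1 h3'.1.2.2.2.2.1 hdiI hdiI'
    obtain ⟨Ψuntr, ⟨hEqU, ⟨τU⟩, -⟩, -⟩ := hcor hsI
    haveI := hEqU
    -- the unit-trivializations `(C_i^istr)^un-tr → F_{Φ_i}`: Frobenioids of standard, isotropic, unit-trivial type
    have hU₁ := isFrobenioid_untr hI₁
    have hU₂ := isFrobenioid_untr hI₂
    have hngU₁ : ¬ (PreFrobenioidData.ofFunctor Φ₁ (untrFunctor hI₁)).IsOfGroupLikeType := fun h =>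
      hGI₁ (isOfGroupLikeType_of_untrData hI₁ h)
    have hngU₂ : ¬ (PreFrobenioidData.ofFunctor Φ₂ (untrFunctor hI₂)).IsOfGroupLikeType := fun h =>
      hGI₂ (isOfGroupLikeType_of_untrData hI₂ h)
    -- the pre-step clause descends to `Ψ^un-tr`, `(Ψ^un-tr)⁻¹` (Prop. 3.3 (iii)/(iv))
    have hPI₁ : ∀ ⦃X' X Y Y' : Istr F₁⦄ (e : X' ⟶ X) (g : X ⟶ Y) (e' : Y ⟶ Y') [IsIso e] [IsIso e'],
        IsPreStep (istrFunctor F₁) g → IsPreStep (istrFunctor F₁) (e ≫ g ≫ e') :=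
      fun _ _ _ _ e _ e' _ _ hg => IsPreStep.iso_comp e (IsPreStep.comp_iso hg e')
    have hPI₂ : ∀ ⦃X' X Y Y' : Istr F₂⦄ (e : X' ⟶ X) (g : X ⟶ Y) (e' : Y ⟶ Y') [IsIso e] [IsIso e'],
        IsPreStep (istrFunctor F₂) g → IsPreStep (istrFunctor F₂) (e ≫ g ≫ e') :=
      fun _ _ _ _ e _ e' _ _ hg => IsPreStep.iso_comp e (IsPreStep.comp_iso hg e')
    have hPU₁ : ∀ ⦃X' X Y Y' : (PreFrobenioidData.ofFunctor Φ₁ (istrFunctor F₁)).Untr⦄ (e : X' ⟶ X) (g : X ⟶ Y)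
        (e' : Y ⟶ Y') [IsIso e] [IsIso e'],
        IsPreStep (untrFunctor hI₁) g → IsPreStep (untrFunctor hI₁) (e ≫ g ≫ e') :=
      fun _ _ _ _ e _ e' _ _ hg => IsPreStep.iso_comp e (IsPreStep.comp_iso hg e')
    have hPU₂ : ∀ ⦃X' X Y Y' : (PreFrobenioidData.ofFunctor Φ₂ (istrFunctor F₂)).Untr⦄ (e : X' ⟶ X) (g : X ⟶ Y)
        (e' : Y ⟶ Y') [IsIso e] [IsIso e'],
        IsPreStep (untrFunctor hI₂) g → IsPreStep (untrFunctor hI₂) (e ≫ g ≫ e') :=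
      fun _ _ _ _ e _ e' _ _ hg => IsPreStep.iso_comp e (IsPreStep.comp_iso hg e')
    obtain ⟨ρ'⟩ := nonempty_inverse_square Ψistr Ψuntr.asEquivalence
      (PreFrobenioidData.ofFunctor Φ₁ (istrFunctor F₁)).toUntr (PreFrobenioidData.ofFunctor Φ₂ (istrFunctor F₂)).toUntr τU
    obtain ⟨σ'⟩ := nonempty_inverse_square Ψistr Ψif
      (PreFrobenioidData.ofFunctor Φ₁ (istrFunctor F₁)).istrι (PreFrobenioidData.ofFunctor Φ₂ (istrFunctor F₂)).istrι
      (eqToIso hcomm)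
    have h₁₂U : PreFrobenioidData.PreservesMor Ψuntr.asEquivalence.functor
        (PreFrobenioidData.ofFunctor Φ₁ (untrFunctor hI₁)).IsPreStep
        (PreFrobenioidData.ofFunctor Φ₂ (untrFunctor hI₂)).IsPreStep := fun X Y g hg =>
      map_mem_of_full_square (PreFrobenioidData.ofFunctor Φ₁ (istrFunctor F₁)).toUntr
        (PreFrobenioidData.ofFunctor Φ₂ (istrFunctor F₂)).toUntr Ψistr.functor Ψuntr τU
        (fun X Y (g : X ⟶ Y) => IsPreStep (untrFunctor hI₁) g) (fun X Y (g : X ⟶ Y) => IsPreStep (untrFunctor hI₂) g)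
        hPU₁ hPU₂
        (fun a b f hf => (isPreStep_toUntr_iff (hF := hI₂) _).mpr
          (map_mem_of_natIso (eqToIso hcomm) (fun X Y (g : X ⟶ Y) => IsPreStep (istrFunctor F₂) g) hPI₂ f
            (h₁₂ f.hom.hom ((isPreStep_toUntr_iff (hF := hI₁) f).mp hf))))
        g hg
    have h₂₁U : PreFrobenioidData.PreservesMor Ψuntr.asEquivalence.inverse
        (PreFrobenioidData.ofFunctor Φ₂ (untrFunctor hI₂)).IsPreStep
        (PreFrobenioidData.ofFunctor Φ₁ (untrFunctor hI₁)).IsPreStep := fun X Y g hg =>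
      map_mem_of_full_square (PreFrobenioidData.ofFunctor Φ₂ (istrFunctor F₂)).toUntr
        (PreFrobenioidData.ofFunctor Φ₁ (istrFunctor F₁)).toUntr Ψistr.inverse Ψuntr.asEquivalence.inverse ρ'
        (fun X Y (g : X ⟶ Y) => IsPreStep (untrFunctor hI₂) g) (fun X Y (g : X ⟶ Y) => IsPreStep (untrFunctor hI₁) g)
        hPU₂ hPU₁
        (fun a b f hf => (isPreStep_toUntr_iff (hF := hI₁) _).mpr
          (map_mem_of_natIso σ' (fun X Y (g : X ⟶ Y) => IsPreStep (istrFunctor F₁) g) hPI₁ f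
            (h₂₁ f.hom.hom ((isPreStep_toUntr_iff (hF := hI₂) f).mp hf))))
        g hg
    have hsU : (PreFrobenioidData.ofFunctor Φ₁ (untrFunctor hI₁)).Cor411Setting
        (PreFrobenioidData.ofFunctor Φ₂ (untrFunctor hI₂)) Ψuntr.asEquivalence :=
      { divSlim := ⟨⟨hs.divSlim.1.eq_one⟩, ⟨hs.divSlim.2.eq_one⟩⟩
        standard := ⟨isOfStandardType_untr hI₁ hGI₁ hSI₁, isOfStandardType_untr hI₂ hGI₂ hSI₂⟩
        hypB := fun hg _ => (hngU₁ hg).elim }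
    -- Prop. 3.2 (iii) for the isotropic parts of the unit-trivializations: PROVED (Frobenius-isotropic type)
    have hPf₁ : IsFrobenioid (Perfection.ops (isFrobenioid_istr hU₁)).toFunctor :=
      Perfection.isFrobenioid _
        (FrdI.T42.isFrobeniusIsotropic_of_isOfIsotropicType (isFrobenioid_istr hU₁) isOfIsotropicType_istr)
    have hPf₂ : IsFrobenioid (Perfection.ops (isFrobenioid_istr hU₂)).toFunctor :=
      Perfection.isFrobenioid _
        (FrdI.T42.isFrobeniusIsotropic_of_isOfIsotropicType (isFrobenioid_istr hU₂) isOfIsotropicType_istr)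
    have hBU₁ := Perfection.birat_isFrobenioid_of_isOfUnitTrivialType (isFrobenioid_istr hU₁) hPf₁
      isOfIsotropicType_istr (isOfUnitTrivialType_istr_of _ (isOfUnitTrivialType_untr hI₁))
    have hBU₂ := Perfection.birat_isFrobenioid_of_isOfUnitTrivialType (isFrobenioid_istr hU₂) hPf₂
      isOfIsotropicType_istr (isOfUnitTrivialType_istr_of _ (isOfUnitTrivialType_untr hI₂))
    -- the base square of `Ψ^un-tr`
    obtain ⟨ΨBase, ⟨hEqB, hsqB, -⟩, -⟩ :=
      cor411ii_of_preservesPreSteps_of_not_isOfGroupLikeType hU₁ hU₂ Ψuntr.asEquivalence hpf₁ hpf₂ h₁₂U h₂₁U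
        hngU₁ hngU₂ hPf₁ hPf₂ hBU₁ hBU₂ hsU
    -- the floors `C_i → C_i^istr → (C_i^istr)^istr → (C_i^istr)^un-tr` over `D_i`
    let L₁ : Istr F₁ ⥤ (PreFrobenioidData.ofFunctor Φ₁ (istrFunctor F₁)).Istr :=
      (PreFrobenioidData.ofFunctor Φ₁ (istrFunctor F₁)).isotropicObjects.lift (𝟭 _) fun X =>
        (PreFrobenioidData.ofFunctor_isIsotropic _ _).mpr (isOfIsotropicType_istr X)
    let L₂ : Istr F₂ ⥤ (PreFrobenioidData.ofFunctor Φ₂ (istrFunctor F₂)).Istr :=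
      (PreFrobenioidData.ofFunctor Φ₂ (istrFunctor F₂)).isotropicObjects.lift (𝟭 _) fun X =>
        (PreFrobenioidData.ofFunctor_isIsotropic _ _).mpr (isOfIsotropicType_istr X)
    have hL₁ : L₁ ⋙ (PreFrobenioidData.ofFunctor Φ₁ (istrFunctor F₁)).istrι = 𝟭 _ :=
      Functor.hext (fun _ => rfl) fun _ _ _ => HEq.rfl
    have hL₂ : L₂ ⋙ (PreFrobenioidData.ofFunctor Φ₂ (istrFunctor F₂)).istrι = 𝟭 _ :=
      Functor.hext (fun _ => rfl) fun _ _ _ => HEq.rfl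
    let T₁ := (isotropification hF₁ ⋙ L₁) ⋙ (PreFrobenioidData.ofFunctor Φ₁ (istrFunctor F₁)).toUntr
    let T₂ := (isotropification hF₂ ⋙ L₂) ⋙ (PreFrobenioidData.ofFunctor Φ₂ (istrFunctor F₂)).toUntr
    have ιU₁ : (PreFrobenioidData.ofFunctor Φ₁ (istrFunctor F₁)).toUntr ⋙
        (PreFrobenioidData.ofFunctor Φ₁ (untrFunctor hI₁)).base ≅
          (PreFrobenioidData.ofFunctor Φ₁ (istrFunctor F₁)).istrι ⋙ (PreFrobenioidData.ofFunctor Φ₁ (istrFunctor F₁)).base :=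
      eqToIso (Functor.hext (fun _ => rfl) fun _ _ a => heq_of_eq (base_toUntr (hF := hI₁) a))
    have ιU₂ : (PreFrobenioidData.ofFunctor Φ₂ (istrFunctor F₂)).toUntr ⋙
        (PreFrobenioidData.ofFunctor Φ₂ (untrFunctor hI₂)).base ≅
          (PreFrobenioidData.ofFunctor Φ₂ (istrFunctor F₂)).istrι ⋙ (PreFrobenioidData.ofFunctor Φ₂ (istrFunctor F₂)).base :=
      eqToIso (Functor.hext (fun _ => rfl) fun _ _ a => heq_of_eq (base_toUntr (hF := hI₂) a))
    obtain ⟨ιf₁⟩ := nonempty_base_iso_isotropification_comp hF₁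
    obtain ⟨ιf₂⟩ := nonempty_base_iso_isotropification_comp hF₂
    have ι₁ : T₁ ⋙ (PreFrobenioidData.ofFunctor Φ₁ (untrFunctor hI₁)).base ≅ (PreFrobenioidData.ofFunctor Φ₁ F₁).base :=
      Functor.associator _ _ _ ≪≫ Functor.isoWhiskerLeft _ ιU₁ ≪≫ Functor.associator _ _ _ ≪≫
        Functor.isoWhiskerLeft (isotropification hF₁) ((Functor.associator _ _ _).symm ≪≫
          Functor.isoWhiskerRight (eqToIso hL₁) _ ≪≫ Functor.leftUnitor _) ≪≫ ιf₁
    have ι₂ : T₂ ⋙ (PreFrobenioidData.ofFunctor Φ₂ (untrFunctor hI₂)).base ≅ (PreFrobenioidData.ofFunctor Φ₂ F₂).base :=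
      Functor.associator _ _ _ ≪≫ Functor.isoWhiskerLeft _ ιU₂ ≪≫ Functor.associator _ _ _ ≪≫
        Functor.isoWhiskerLeft (isotropification hF₂) ((Functor.associator _ _ _).symm ≪≫
          Functor.isoWhiskerRight (eqToIso hL₂) _ ≪≫ Functor.leftUnitor _) ≪≫ ιf₂
    -- `Ψ^istr` over `Ψ` along the isotropifications (Thm. 3.4 (i): uniqueness of left adjoints)
    obtain ⟨core⟩ := nonempty_isotropification_comp_iso hF₁ hF₂ hq₁ hq₂ Ψ
    have HL : ((isotropification hF₁ ⋙ L₁) ⋙ Ψistr.functor) ⋙ (PreFrobenioidData.ofFunctor Φ₂ (istrFunctor F₂)).istrι ≅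
        isotropification hF₁ ⋙ Ψif.functor :=
      Functor.associator _ _ _ ≪≫ Functor.isoWhiskerLeft _ (eqToIso hcomm) ≪≫ Functor.associator _ _ _ ≪≫
        Functor.isoWhiskerLeft (isotropification hF₁)
          ((Functor.associator _ _ _).symm ≪≫ Functor.isoWhiskerRight (eqToIso hL₁) _ ≪≫ Functor.leftUnitor _)
    have HR : (Ψ.functor ⋙ (isotropification hF₂ ⋙ L₂)) ⋙ (PreFrobenioidData.ofFunctor Φ₂ (istrFunctor F₂)).istrι ≅
        isotropification hF₁ ⋙ Ψif.functor :=
      Functor.associator _ _ _ ≪≫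
        Functor.isoWhiskerLeft Ψ.functor (Functor.associator _ _ _ ≪≫
          Functor.isoWhiskerLeft (isotropification hF₂) (eqToIso hL₂) ≪≫ Functor.rightUnitor _) ≪≫ core.symm
    have G : (isotropification hF₁ ⋙ L₁) ⋙ Ψistr.functor ≅ Ψ.functor ⋙ (isotropification hF₂ ⋙ L₂) :=
      ((PreFrobenioidData.ofFunctor Φ₂ (istrFunctor F₂)).isotropicObjects.fullyFaithfulι.whiskeringRight C₁).preimageIso
        (HL ≪≫ HR.symm)
    have hT : OneCommutes Ψ.functor T₂ T₁ Ψuntr :=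
      ⟨(Functor.associator _ _ _).symm ≪≫ Functor.isoWhiskerRight G.symm _ ≪≫ Functor.associator _ _ _ ≪≫
        Functor.isoWhiskerLeft _ τU ≪≫ (Functor.associator _ _ _).symm⟩
    -- descend
    exact cor411ii_of_over hF₁ hF₂ Ψ T₁ T₂ _ _ ι₁ ι₂ Ψuntr hT ⟨ΨBase, hEqB, hsqB⟩ hs

/-- **[FrdI] Cor. 4.11 (ii) AS TYPED from Thm. 3.4 (ii) AS TYPED** (`PreFrobenioidData.Thm34ii` for `Ψ` and
for `Ψ⁻¹`): the antecedents of the typed Thm. 3.4 (ii) — quasi-isotropic type and bases of FSMFF-type — are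
clauses (a) and (d) of the standard type recorded in `Cor411Setting`, so the typed Cor. 4.11 (ii) for
Frobenioids with perf-factorial `Φ_i` follows from the typed Thm. 3.4 (ii) with no further hypothesis.
[cite: MochizukiFrdI2008, Cor. 4.11 (ii) p.91] -/
theorem cor411ii_ofFunctor_of_thm34ii (hF₁ : IsFrobenioid F₁) (hF₂ : IsFrobenioid F₂) (Ψ : C₁ ≌ C₂)
    (hpf₁ : Objectwise (fun M _ => IsPerfFactorial M) Φ₁) (hpf₂ : Objectwise (fun M _ => IsPerfFactorial M) Φ₂)
    (h : (PreFrobenioidData.ofFunctor Φ₁ F₁).Thm34ii (PreFrobenioidData.ofFunctor Φ₂ F₂) Ψ)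
    (h' : (PreFrobenioidData.ofFunctor Φ₂ F₂).Thm34ii (PreFrobenioidData.ofFunctor Φ₁ F₁) Ψ.symm) :
    (PreFrobenioidData.ofFunctor Φ₁ F₁).Cor411ii (PreFrobenioidData.ofFunctor Φ₂ F₂) Ψ := by
  intro hs
  obtain ⟨h₁₂, -, hG⟩ := h hs.standard.1.quasiIsotropic hs.standard.2.quasiIsotropic hs.standard.1.fsmff
    hs.standard.2.fsmff
  obtain ⟨h₂₁, -, hG'⟩ := h' hs.standard.2.quasiIsotropic hs.standard.1.quasiIsotropic hs.standard.2.fsmff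
    hs.standard.1.fsmff
  exact cor411ii_ofFunctor_of_preservesPreSteps hF₁ hF₂ Ψ hpf₁ hpf₂ h₁₂ h₂₁ hG hG' hs

/-- **[FrdI] Cor. 4.11 (ii) AS TYPED over bases of FSMFF-type in the author's revised (2024) sense** — the
generality in which the author now states Thm. 3.4 (ii) (*Comments* (2024) item (28);
`FrdI.thm34ii_of_isOfFSMFFType2024`): for Frobenioids `C_i → F_{Φ_i}` with `Φ_i` perf-factorial over such
bases, unconditionally. [cite: MochizukiFrdI2008, Cor. 4.11 (ii) p.91] -/
theorem cor411ii_ofFunctor_of_isOfFSMFFType2024 (hF₁ : IsFrobenioid F₁) (hF₂ : IsFrobenioid F₂) (Ψ : C₁ ≌ C₂)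
    (hpf₁ : Objectwise (fun M _ => IsPerfFactorial M) Φ₁) (hpf₂ : Objectwise (fun M _ => IsPerfFactorial M) Φ₂)
    (hD₁ : IsOfFSMFFType2024 D₁) (hD₂ : IsOfFSMFFType2024 D₂) :
    (PreFrobenioidData.ofFunctor Φ₁ F₁).Cor411ii (PreFrobenioidData.ofFunctor Φ₂ F₂) Ψ := by
  intro hs
  obtain ⟨h₁₂, -, hG⟩ := FrdI.thm34ii_of_isOfFSMFFType2024 hF₁ hF₂ hs.standard.1.quasiIsotropic
    hs.standard.2.quasiIsotropic hD₁ hD₂ Ψ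
  obtain ⟨h₂₁, -, hG'⟩ := FrdI.thm34ii_of_isOfFSMFFType2024 hF₂ hF₁ hs.standard.2.quasiIsotropic
    hs.standard.1.quasiIsotropic hD₂ hD₁ Ψ.symm
  exact cor411ii_ofFunctor_of_preservesPreSteps hF₁ hF₂ Ψ hpf₁ hpf₂ h₁₂ h₂₁ hG hG' hs

end Two

end PreFrobenioid

end Literature.AlgebraicGeometry.Frobenioids
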